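import Summits.AtomisticToContinuum.FouriersLaw.Theorems.BondHeatUncertaintyBoundedResponseTransientContactBudget
import Summits.AtomisticToContinuum.FouriersLaw.Theorems.BondHeatUncertaintySubdiffusiveBondHeatTransientSpectral
import Summits.AtomisticToContinuum.FouriersLaw.Theorems.FourierGreenKuboFourierFiniteResponseOfUnique
import Summits.AtomisticToContinuum.FouriersLaw.Theorems.BondHeatUncertaintySubdiffusiveBondHeatSpectralNonneg
import Summits.AtomisticToContinuum.FouriersLaw.Theorems.BoundaryEscapeDeficitBoundaryKernelBasics
import Summits.AtomisticToContinuum.FouriersLaw.Theorems.BondHeatUncertaintyBoundedResponseTransientBandD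

/-!
(SPLIT FOR THE 400-LINE CAP by the landing lane, hand-2 g35: this file = part 1 of 3; sequels `…BondHeatUncertaintyBoundedResponseTransientContactSpectrumB`, `…BondHeatUncertaintyBoundedResponseTransientContactSpectrum` import it in a chain; same namespace, all FQNs unchanged.)
# `BoundedResponse` (stmt-AtomisticToContinuum-11071) · door «TransientContactBudget», node 2:
# the surplus `P` in equilibrium currency, its exactness, and its frequency-band grading
(LANDING-LANE NOTE, hand-2 g35: the thirteen abstract kernel lemmas of §«Real analysis» and § HighBandFree — verbatim twins of node B «TransientBand»'s, landed first — are CITED from `…BoundedResponse.TransientBand` instead of restated (gate `dedup.landed`); nothing else changed.)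

Second node (decomposition cell `decomp-a2c`, lens «grading / quantitative ladder», g92) beneath the
landed junction `boundedResponse_of_transientContact'`
(`Theorems/BondHeatUncertaintyBoundedResponseTransientContactBudget.lean`, node g91):
`BoundedResponse ⟸ K_T ∧ W ∧ P ∧ (S)` with `K_T = TransientContactBudgetFixedN` (fixed `N`),
`W = ExtensiveBlockEnergyVariance`, `P = TransientContactSurplus`, `(S) = SubdiffusiveBondHeat` (9120).
This file works on the residual `P` only; nothing of the route is restated, no fact is vendored (the six
`def … : Prop` below are typed statements: two of them, `(R)` and `(HB)`, are PROVED in this file; the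
other four are hypotheses of conditional theorems, like `K_T`/`W`/`P` of node g91).

## What is proved here (no `sorry`)

1. **`P` is necessary** (`transientContactSurplus_of_boundedResponse`): linear-order Clausius
   `(Q) TransientContactHeatNonneg` (`q_L^N(τ) ≥ 0`, fixed `N`) and `BoundedResponse` give `P` with
   `C = 2c·sup_N |D_N|`; hence **`BoundedResponse ⟺ P` under `K_T ∧ W ∧ (Q) ∧ (S)`**
   (`boundedResponse_iff_transientContactSurplus`).  The door is EXACT at `P`.
2. **Language change** (`transientContactSurplus_of_equilibriumSurplusFloor`,
   `equilibriumSurplusFloor_of_boundedResponse`, `boundedResponse_iff_equilibriumSurplusFloor`): with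
   the contact kernel integrable `(R) ContactKernelRegular` and the boundary Green–Kubo identity
   `(GK) ContactGreenKubo` (`D_N = (N−1)(γ/2 − T²∫₀^∞ C^g_N)`, both fixed-`N` theorem-grade; `GK` is the
   `C^g`-form of the tree's PROVED `HonestZwanzig.OpenChainGreenKubo`), the closed form splits as
   `q_L^N(τ) = τ·G_N + s_N(τ)` (`contactHeatResponse_eq_linear_add_surplus`, from the real-analysis
   identity `integral_min_mul_eq_sub`), and `P` becomes the **equilibrium surplus floor**
   `(ESF) EquilibriumSurplusFloor`: `s_N(cN²) = T² ∫₀^∞ min(u, cN²) C^g_N(u) du ≥ −C·N` — ONE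
   equilibrium autocorrelation function per `N`, no steady state, no response coefficient; and
   `ESF ⟺ BoundedResponse` under the bracket (both directions proved; the necessity direction uses the
   tree's PROVED existence of steady states and of response limits).
3. **Frequency-band grading** (`integral_min_mul_ge_of_floor`, the mirror image of the tree's
   `transientTail_le_sqrt_of_warburg`; `equilibriumSurplusFloor_of_spectralFloors`): by the spectral
   representation `c₁ s_N(τ) = T² ∫₀^∞ (1 − cos ωτ) ω⁻² D_N(ω) dω` of the tree
   (`integral_min_mul_eq_spectral`) with the DIP `D_N(ω) = ∫₀^∞ (1 − cos ωu) C^g_N(u) du` of the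
   contact-imbalance spectrum (`contactDip`; `contactSurplus_eq_spectral`), the floor `ESF` follows from
   * `(HB) HighBandSurplusFloor` — the microscopic band `ω > 1` contributes `≥ −B` (theorem-grade:
     Bochner positivity of the contact spectrum + a Fejér average, uniformly in `N`), and
   * `(WF) ContactWarburgFloor` — the INFRARED band: `D_N(ω) ≥ −A√ω` on `0 < ω ≤ 1` ("the AC contact
     conductance never drops below DC by more than `AT²√ω`"), the residual,
   with `s_N(cN²) ≥ −T²((max A 0)c₂ + max B 0)/c₁ · √c · N`.
4. **`(R)` and `(HB)` are theorems** (`contactKernelRegular_holds`, `highBandSurplusFloor_holds`, with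
   `B = 32 c₁ γ²/T²` for every `N ≥ 1`).  Two layers: (a) pure real analysis
   (`highBand_spectral_ge`): for ANY measurable `K ∈ L¹(0,∞)` with `|K| ≤ B₀` whose Fejér integrals
   `∫₀ᵗ (t − r) cos(ωr) K(r) dr` are `≥ 0` (a positive-definite stationary kernel),
   `∫_{ω>1} (1 − cos ωt) ω⁻² D_K(ω) dω ≥ −16 c₁ B₀` for all `t ≥ 0` — Bochner positivity `K̂ ≥ 0`
   (`integral_Ioi_nonneg_of_lagIntegral_nonneg` of the tree) kills the `t`-dependent term, and the
   `t`-free term `∫_{ω>1} K̂(ω) ω⁻² dω` is bounded by a CONTINUUM Fejér average over windows `s ∈ (0,2]`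
   (`(2 − sin 2ω/ω)/ω² ≥ 1/ω²` on `ω ≥ 1`; Fubini; `c₁ ∫₀ˢ (s − u) K = ∫ (1 − cos ωs) ω⁻² K̂`), i.e. by
   `8 c₁ B₀` — no decay RATE of `K` enters, which is what makes the constant uniform in `N`;
   (b) the fixed-`N` stochastic analysis of the tree run for a general exponentially dominated
   observable (`measurable_obsCorr`, `obsCorr_abs_le`, `obsCorr_exp_decay`, `obsCorr_integrableOn`:
   CEHR exponential mixing, Jensen for the Markov kernel, Gibbs invariance) and the statics of
   `g = (γ/2T²)(p_0² − p_{N−1}²)` (`contactImbalance_statics`: mean zero, `∫ g² dμ_T ≤ 2γ²/T²` for every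
   `N`, from the Gaussian momentum marginal at BOTH ends, `integral_kinDev_sq_le`), whence
   `sup_{N,u} |C^g_N(u)| ≤ 2γ²/T²` (`abs_contactImbalanceCorr_le`) and Fejér positivity of `C^g_N`
   (`contactImbalanceCorr_lagIntegral_nonneg`, from `pinnedChain_lagIntegral_cos_mul_nonneg`).
5. **The refined door** (`boundedResponse_of_contactWarburgFloor`):
   `BoundedResponse ⟸ K_T ∧ W ∧ (S) ∧ [GK ∧ WF]`, and
   (`boundedResponse_of_equilibriumSurplusFloor'`) `⟸ K_T ∧ W ∧ (S) ∧ [GK ∧ ESF]`, with the exactness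
   certificate `BoundedResponse ⟺ ESF` under `K_T ∧ W ∧ (Q) ∧ (S) ∧ GK`
   (`boundedResponse_iff_equilibriumSurplusFloor'`).

Grading verdict (lens): along this door the theorems stop exactly at the INFRARED THRESHOLD of the
contact spectrum — everything at `ω > 1` and everything at fixed `N` is theorem-grade (the fixed-`N`
items `K_T`, `(Q)`, `GK` are identities of the `(★)` lineage); the `N`-uniform content of
`BoundedResponse` not already carried by `(S)` and `W` is the one-sided floor at `ω → 0`: exactly
`ESF` (equivalent), conveniently `WF` (sufficient; Hölder-½, the mirror image of the `√ω`-CEILING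
`ContactWarburgModulus` that feeds `(S)`).  All `N`-uniform residual inputs (`(S)`, `W`, `WF`/`ESF`)
are EQUILIBRIUM statements about `μ_T` and the constructed flow.
-/

noncomputable section

namespace Summit.AtomisticToContinuum.FouriersLaw.Theorems.BoundedResponse.TransientContact

open MeasureTheory ProbabilityTheory Filter Set Topology
open Literature.MathematicalPhysics.KineticTheory.HeatConduction
open Summit.AtomisticToContinuum.FouriersLaw.Theses.BondHeatUncertainty
open Summit.AtomisticToContinuum.FouriersLaw.Theorems.SubdiffusiveBondHeat
open Summit.AtomisticToContinuum.FouriersLaw.Theorems.BoundedResponse.TransientBand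
  (integral_min_mul_eq_sub integral_min_mul_ge_of_floor integrableOn_cos_mul_kernel abs_cosTransform_le dip_eq_sub_cosTransform
    measurable_cosTransform cosTransform_nonneg_of_lagIntegral_nonneg integral_fejer_mul_cosTransform fejerWeight_le integral_Ioc_fejerWeight
    one_le_two_sub_sin_div integrable_fejerAverage highBand_spectral_ge)

/-! ### Equilibrium objects on the frequency side -/

/-- The **dip of the contact-imbalance spectrum** `D_N(ω) := ∫_{(0,∞)} (1 − cos ωu) C^g_N(u) du`
(`= Ĉ^g_N(0) − Ĉ^g_N(ω)`, cosine transforms; in conductance terms `(G_N(ω) − G_N(0))/T²` with the AC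
contact conductance `G_N(ω) = γ/2 − T² ∫ cos(ωu) C^g_N(u) du`). [folklore] -/
def contactDip (P : OscillatorChain) (T : ℝ) (N : ℕ) (ω : ℝ) : ℝ :=
  ∫ u in Ioi 0, (1 - Real.cos (ω * u)) * contactImbalanceCorr P T N u

/-- The **equilibrium contact surplus** `s_N(τ) := T² ∫_{(0,∞)} min(u,τ) C^g_N(u) du`
(`= q_L^N(τ) − τ·G_N` once `C^g_N ∈ L¹`, see `contactHeatResponse_eq_linear_add_surplus`; spectrally
`c₁ s_N(τ) = T² ∫_{(0,∞)} (1 − cos ωτ) ω⁻² D_N(ω) dω`). [folklore] -/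
def contactSurplus (P : OscillatorChain) (T : ℝ) (N : ℕ) (τ : ℝ) : ℝ :=
  T ^ 2 * ∫ u in Ioi 0, min u τ * contactImbalanceCorr P T N u

/-- Closed form = linear part + surplus: `q_L^N(τ) = τ(γ/2 − T²∫_{(0,∞)} C^g_N) + s_N(τ)` for `τ ≥ 0`
whenever `C^g_N` is measurable and integrable on `(0,∞)`. [folklore] -/
theorem contactHeatResponse_eq_linear_add_surplus (P : OscillatorChain) (T : ℝ) (N : ℕ)
    (hi : IntegrableOn (contactImbalanceCorr P T N) (Ioi 0)) {τ : ℝ} (hτ : 0 ≤ τ) :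
    contactHeatResponse P T N τ =
      τ * (P.γ / 2 - T ^ 2 * ∫ u in Ioi 0, contactImbalanceCorr P T N u) +
        contactSurplus P T N τ := by
  unfold contactHeatResponse contactSurplus
  rw [integral_min_mul_eq_sub hi hτ]
  ring

/-- **Fejér reading of the surplus**: `c₁ · s_N(τ) = T² ∫_{(0,∞)} (1 − cos ωτ) ω⁻² D_N(ω) dω` for
`τ ≥ 0` whenever `C^g_N` is measurable and integrable on `(0,∞)` (the tree's spectral representation of
`min`, `integral_min_mul_eq_spectral`). [folklore] -/
theorem contactSurplus_eq_spectral (P : OscillatorChain) (T : ℝ) (N : ℕ)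
    (hm : Measurable (contactImbalanceCorr P T N))
    (hi : IntegrableOn (contactImbalanceCorr P T N) (Ioi 0)) {τ : ℝ} (hτ : 0 ≤ τ) :
    (∫ ω in Ioi (0 : ℝ), (1 - Real.cos ω) / ω ^ 2) * contactSurplus P T N τ =
      T ^ 2 * ∫ ω in Ioi (0 : ℝ), (1 - Real.cos (ω * τ)) / ω ^ 2 * contactDip P T N ω := by
  unfold contactSurplus contactDip
  rw [mul_left_comm, integral_min_mul_eq_spectral hm hi hτ]

/-! ### Typed pieces -/

/-- **(Q) `TransientContactHeatNonneg`** — linear-order Clausius for the transient contact heat (fixed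
`N`, theorem-grade): `q_L^N(τ) ≥ 0` for all `τ ≥ 0`.  Mechanism: the Gibbs-started transient
fluctuation relation plus reflection symmetry give `q_L^N(τ) = Var_eq(Q^avg_τ)/(2T²)`; same technology as
`TransientContactBudgetFixedN`.  Why it might fail: only through a mis-typed closed form (it is the
`δ`-derivative of a mean heat that flows from hot to cold at linear order). [route statement · this cell; NOT a literature fact] -/
def TransientContactHeatNonneg : Prop :=
  ∀ ω₂ lam β γ : ℝ, 0 < ω₂ → 0 < lam → 0 < β → 0 < γ → ∀ T : ℝ, 0 < T →
    ∀ (N : ℕ) (τ : ℝ), 0 ≤ τ →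
      0 ≤ contactHeatResponse (pinnedChain ω₂ lam β γ) T N τ

/-- **(R) `ContactKernelRegular`** — fixed-`N` regularity of the contact kernel: `C^g_N` is
measurable and integrable on `(0,∞)` (indeed `|C^g_N(u)| ≤ C_N e^{−c_N u}`: the `g`-analogue of the
landed `BoundaryKernelBasics` for `K_N`).  PROVED below for every `N` (`contactKernelRegular_holds`:
exponential mixing of the equal-temperature chain); kept as a named `Prop` because the spectral
identities are stated over it. (after CuneoEckmannHairerReyBellet2018, Thm 2.13) [route statement · this cell; NOT a literature fact] -/
def ContactKernelRegular : Prop :=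
  ∀ ω₂ lam β γ : ℝ, 0 < ω₂ → 0 < lam → 0 < β → 0 < γ → ∀ T : ℝ, 0 < T →
    ∀ N : ℕ, Measurable (contactImbalanceCorr (pinnedChain ω₂ lam β γ) T N) ∧
      IntegrableOn (contactImbalanceCorr (pinnedChain ω₂ lam β γ) T N) (Ioi 0)

/-- **(GK) `ContactGreenKubo`** — the open-chain Green–Kubo identity through the boundary source (fixed
`N`, theorem-grade): along any steady-state family the response coefficient is
`D_N = (N − 1)·(γ/2 − T² ∫_{(0,∞)} C^g_N)`.  Route to a proof: the tree's exact response identity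
`Theorems.OpenChainGreenKubo.totalCurrent_eq_bias_mul_pairing` (`J_N(μ_δ) = (δ/T²)∫∫ g·P^δ_s J_tot`)
and its `δ → 0` continuity (cone of `OddSectorIrreversibility.Corrector.openChainGreenKubo_holds`), then the equilibrium identity
`∫₀^∞ ⟨g, P_s j_b⟩ ds = γ/2 − T²∫C^g_N` per bond (block-energy balance, `Cov_μT(g, E_{≤b}) = γ/2`,
reflection symmetry, mixing).  Why it might fail: only by mis-typing (junk value of `∫_{(0,∞)}` if
`C^g_N ∉ L¹`, excluded by (R)). (after KunduDharNarayan2009, p. 3) [route statement · this cell; NOT a literature fact] -/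
def ContactGreenKubo : Prop :=
  ∀ ω₂ lam β γ : ℝ, 0 < ω₂ → 0 < lam → 0 < β → 0 < γ →
    ∀ μ : (N : ℕ) → ℝ → ℝ → Measure (PhaseSpace N),
      (∀ (N : ℕ) (T_L T_R : ℝ), 0 < T_L → 0 < T_R →
        (pinnedChain ω₂ lam β γ).IsSteadyState N T_L T_R (μ N T_L T_R)) →
      ∀ T : ℝ, 0 < T → ∀ D : ℕ → ℝ,
        (∀ N : ℕ, Tendsto (fun δ : ℝ =>
            (pinnedChain ω₂ lam β γ).totalCurrent (μ N (T + δ / 2) (T - δ / 2)) / δ)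
          (nhdsWithin 0 {(0 : ℝ)}ᶜ) (nhds (D N))) →
        ∀ N : ℕ, 2 ≤ N →
          D N = ((N : ℝ) - 1) *
            ((pinnedChain ω₂ lam β γ).γ / 2 -
              T ^ 2 * ∫ u in Ioi 0, contactImbalanceCorr (pinnedChain ω₂ lam β γ) T N u)

/-- **(ESF) `EquilibriumSurplusFloor`** — the surplus `P` in EQUILIBRIUM currency (`N`-uniform, the
residual of this node): for every Thouless fraction `c > 0` there is `C` with
`s_N(cN²) = T² ∫_{(0,∞)} min(u, cN²) C^g_N(u) du ≥ −C·N` for all `N ≥ 2`.  No steady state, no response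
coefficient: a statement about ONE equilibrium autocorrelation function per `N`.  Why it might fail: a
negative post-injection plateau of `C^g_N` of size `≫ N^{-3}` lasting up to the Thouless time (diffusive
back-flow stronger than Ohmic), which would make the transient contact budget miss `D_N = O(1)`.
[route statement · this cell; NOT a literature fact] -/
def EquilibriumSurplusFloor : Prop :=
  ∀ ω₂ lam β γ : ℝ, 0 < ω₂ → 0 < lam → 0 < β → 0 < γ → ∀ T : ℝ, 0 < T →
    ∀ c : ℝ, 0 < c → ∃ C : ℝ, ∀ N : ℕ, 2 ≤ N →
      -(C * N) ≤ contactSurplus (pinnedChain ω₂ lam β γ) T N (c * (N : ℝ) ^ 2)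

/-- **(WF) `ContactWarburgFloor`** — the INFRARED piece (`N`-uniform, UNDECIDED; residual): the dip of
the contact-imbalance spectrum obeys the one-sided Hölder-½ floor `D_N(ω) ≥ −A√ω` on `0 < ω ≤ 1` for
`N ≥ N₀` — "the AC contact conductance never drops below its DC value by more than `A T²√ω`".  The
mirror image of the `(S)`-side `ContactWarburgModulus` (a `√ω` CEILING on the dip of the bath kernel
`K_N`).  Why it might fail: Fabry–Pérot structure — in a ballistic (harmonic or near-integrable) regime
the AC conductance oscillates in `ω` with period `∼ 1/N` and `O(1)` amplitude, violating the floor at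
`ω ∼ 1/N`; the statement bets on diffusive smoothing of the contact spectrum. [route statement · this cell; NOT a literature fact] -/
def ContactWarburgFloor : Prop :=
  ∀ ω₂ lam β γ : ℝ, 0 < ω₂ → 0 < lam → 0 < β → 0 < γ → ∀ T : ℝ, 0 < T →
    ∃ A : ℝ, ∃ N₀ : ℕ, ∀ N : ℕ, N₀ ≤ N → ∀ ω : ℝ, 0 < ω → ω ≤ 1 →
      -(A * Real.sqrt ω) ≤ contactDip (pinnedChain ω₂ lam β γ) T N ω

/-- **(HB) `HighBandSurplusFloor`** — the MICROSCOPIC-BAND piece (`N`-uniform): the `ω > 1` part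
of the Fejér integral of the dip is bounded below uniformly,
`∫_{(1,∞)} (1 − cos ωt) ω⁻² D_N(ω) dω ≥ −B` for all `t ≥ 1`, `N ≥ N₀`.  PROVED below with
`B = 32 c₁ γ²/T²`, `N₀ = 1` (`highBandSurplusFloor_holds`): Bochner positivity of the contact spectrum
`Ĉ^g_N ≥ 0` (the tree's `SpectralPositivity` technology with `f = g`), whence
`D_N(ω) ≥ Ĉ^g_N(0) − Ĉ^g_N(ω) ≥ −Ĉ^g_N(ω)` in the `t`-dependent term, and the continuum Fejér average
`∫_{(1,∞)} ω⁻² Ĉ^g_N ≤ ∫₀² ∫ (1 − cos ωs) ω⁻² Ĉ^g_N dω ds = c₁ ∫₀² ∫₀ˢ (s − u) C^g_N ≤ 8c₁·sup|C^g_N|`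
with `sup_{N,u} |C^g_N(u)| ≤ 2γ²/T²` (Gaussian fourth moments under `μ_T` at both ends). [route statement · this cell; NOT a literature fact] -/
def HighBandSurplusFloor : Prop :=
  ∀ ω₂ lam β γ : ℝ, 0 < ω₂ → 0 < lam → 0 < β → 0 < γ → ∀ T : ℝ, 0 < T →
    ∃ B : ℝ, ∃ N₀ : ℕ, ∀ N : ℕ, N₀ ≤ N → ∀ t : ℝ, 1 ≤ t →
      -B ≤ ∫ ω in Ioi 1,
        (1 - Real.cos (ω * t)) / ω ^ 2 * contactDip (pinnedChain ω₂ lam β γ) T N ω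

/-! ### `P` is necessary: `(Q) ∧ BoundedResponse ⟹ P`, hence `BoundedResponse ⟺ P` under the bracket -/

/-- **Necessity of the surplus.**  Linear-order Clausius `q_L^N ≥ 0` and `sup_N |D_N| < ∞` give the
transient contact surplus with `C = 2c·sup_N |D_N|`. [folklore] -/
theorem transientContactSurplus_of_boundedResponse (hQ : TransientContactHeatNonneg)
    (hB : BoundedResponse) : TransientContactSurplus := by
  intro ω₂ lam β γ hω hl hβ hγ μ hμ T hT D hD c hc
  obtain ⟨Dstar, hDstar⟩ := hB ω₂ lam β γ hω hl hβ hγ μ hμ T hT D hD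
  have hDs : ∀ N : ℕ, |D N| ≤ Dstar := fun N => hDstar ⟨N, rfl⟩
  have hDs0 : 0 ≤ Dstar := (abs_nonneg _).trans (hDs 0)
  refine ⟨2 * c * Dstar, fun N hN => ?_⟩
  have hN2 : (2 : ℝ) ≤ N := by exact_mod_cast hN
  have hq : 0 ≤ contactHeatResponse (pinnedChain ω₂ lam β γ) T N (c * (N : ℝ) ^ 2) :=
    hQ ω₂ lam β γ hω hl hβ hγ T hT N _ (by positivity)
  have hDN : D N ≤ Dstar := (le_abs_self _).trans (hDs N)
  have h1 : c * (N : ℝ) ^ 2 * D N ≤ c * (N : ℝ) ^ 2 * Dstar :=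
    mul_le_mul_of_nonneg_left hDN (by positivity)
  have h2 : c * (N : ℝ) ^ 2 * Dstar ≤ ((N : ℝ) - 1) * (2 * c * Dstar * N) := by
    have : (N : ℝ) ^ 2 ≤ ((N : ℝ) - 1) * (2 * N) := by nlinarith
    nlinarith [mul_nonneg hc.le hDs0]
  have h3 : ((N : ℝ) - 1) * (2 * c * Dstar * N) ≤
      ((N : ℝ) - 1) * (contactHeatResponse (pinnedChain ω₂ lam β γ) T N (c * (N : ℝ) ^ 2) +
        2 * c * Dstar * N) :=
    mul_le_mul_of_nonneg_left (by linarith) (by linarith)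
  linarith

/-- **Exactness of the door at `P`.**  Under the fixed-`N` bracket (`TransientContactBudgetFixedN`,
linear-order Clausius `TransientContactHeatNonneg`), extensive block-energy fluctuations and the
sub-diffusive bond heat `(S)`, the transient contact surplus is EQUIVALENT to bounded response (the
backward direction is the landed junction `boundedResponse_of_transientContact'`). [folklore] -/
theorem boundedResponse_iff_transientContactSurplus (hK : TransientContactBudgetFixedN)
    (hW : ExtensiveBlockEnergyVariance) (hQ : TransientContactHeatNonneg)
    (hS : SubdiffusiveBondHeat) : BoundedResponse ↔ TransientContactSurplus :=
  ⟨fun hB => transientContactSurplus_of_boundedResponse hQ hB,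
    fun hP => boundedResponse_of_transientContact' hK hW hP hS⟩

/-! ### Language change: `P ⟸ (R) ∧ (GK) ∧ (ESF)` -/

/-- **The surplus in equilibrium currency suffices.**  With the contact kernel integrable (R) and the
boundary Green–Kubo identity (GK), `(N−1)·q_L^N(τ) = τ·D_N + (N−1)·s_N(τ)`, so the equilibrium floor
`s_N(cN²) ≥ −CN` is exactly the transient contact surplus `P` (same `c`, same `C`). [folklore] -/
theorem transientContactSurplus_of_equilibriumSurplusFloor (hR : ContactKernelRegular)
    (hG : ContactGreenKubo) (hE : EquilibriumSurplusFloor) : TransientContactSurplus := by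
  intro ω₂ lam β γ hω hl hβ hγ μ hμ T hT D hD c hc
  obtain ⟨C, hC⟩ := hE ω₂ lam β γ hω hl hβ hγ T hT c hc
  refine ⟨C, fun N hN => ?_⟩
  obtain ⟨-, hi⟩ := hR ω₂ lam β γ hω hl hβ hγ T hT N
  have hGK := hG ω₂ lam β γ hω hl hβ hγ μ hμ T hT D hD N hN
  have hid := contactHeatResponse_eq_linear_add_surplus (pinnedChain ω₂ lam β γ) T N hi
    (τ := c * (N : ℝ) ^ 2) (by positivity)
  have hs := hC N hN
  have hN1 : (1 : ℝ) ≤ (N : ℝ) - 1 := by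
    have : (2 : ℝ) ≤ N := by exact_mod_cast hN
    linarith
  rw [hid, hGK]
  have key : 0 ≤ ((N : ℝ) - 1) *
      (contactSurplus (pinnedChain ω₂ lam β γ) T N (c * (N : ℝ) ^ 2) + C * N) :=
    mul_nonneg (by linarith) (by linarith)
  nlinarith

/-- **Necessity of the equilibrium floor.**  Conversely, bounded response and linear-order Clausius
give the equilibrium surplus floor, through the PROVED existence of steady states
(`pinnedChain_exists_isSteadyState`, Carmona / Cuneo–Eckmann–Hairer–Rey-Bellet) and of the response
limits (`FourierGreenKubo.finiteResponse_of_unique` with `nessUnique_proof`): so, modulo the fixed-`N`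
bracket `(R) ∧ (GK) ∧ (Q)`, `ESF` is EXACTLY as strong as `P`, i.e. as `BoundedResponse` itself under
`K_T ∧ W ∧ (S)`. [folklore] -/
theorem equilibriumSurplusFloor_of_boundedResponse (hR : ContactKernelRegular)
    (hG : ContactGreenKubo) (hQ : TransientContactHeatNonneg) (hB : BoundedResponse) :
    EquilibriumSurplusFloor := by
  classical
  intro ω₂ lam β γ hω hl hβ hγ T hT c hc
  have hUq :=
    Summit.AtomisticToContinuum.FouriersLaw.Theorems.nessUnique_proof ω₂ lam β γ hω hl hβ hγ
  -- a steady-state family (choice over the proved existence)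
  obtain ⟨μ, hμ⟩ : ∃ μ : (N : ℕ) → ℝ → ℝ → Measure (PhaseSpace N),
      ∀ (N : ℕ) (T_L T_R : ℝ), 0 < T_L → 0 < T_R →
        (pinnedChain ω₂ lam β γ).IsSteadyState N T_L T_R (μ N T_L T_R) := by
    refine ⟨fun N T_L T_R => if h : 0 < T_L ∧ 0 < T_R then
      Classical.choose (pinnedChain_exists_isSteadyState hω hl hβ hγ N h.1 h.2) else 0, ?_⟩
    intro N T_L T_R h1 h2
    simp only [dif_pos (And.intro h1 h2)]
    exact Classical.choose_spec (pinnedChain_exists_isSteadyState hω hl hβ hγ N h1 h2)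
  -- the response coefficients exist (open-chain Green–Kubo, proved in the tree)
  have hDex : ∀ N : ℕ, ∃ D : ℝ, Tendsto (fun δ : ℝ =>
      (pinnedChain ω₂ lam β γ).totalCurrent (μ N (T + δ / 2) (T - δ / 2)) / δ)
      (nhdsWithin 0 {(0 : ℝ)}ᶜ) (nhds D) :=
    fun N =>
      Summit.AtomisticToContinuum.FouriersLaw.Theorems.FourierGreenKubo.finiteResponse_of_unique
        ω₂ lam β γ hω hl hβ hγ hUq μ hμ T hT N
  choose D hD using hDex
  obtain ⟨C, hC⟩ :=
    transientContactSurplus_of_boundedResponse hQ hB ω₂ lam β γ hω hl hβ hγ μ hμ T hT D hD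
      c hc
  refine ⟨C, fun N hN => ?_⟩
  obtain ⟨-, hi⟩ := hR ω₂ lam β γ hω hl hβ hγ T hT N
  have hGK := hG ω₂ lam β γ hω hl hβ hγ μ hμ T hT D hD N hN
  have hid := contactHeatResponse_eq_linear_add_surplus (pinnedChain ω₂ lam β γ) T N hi
    (τ := c * (N : ℝ) ^ 2) (by positivity)
  have h := hC N hN
  rw [hid, hGK] at h
  have hN1 : (1 : ℝ) ≤ (N : ℝ) - 1 := by
    have : (2 : ℝ) ≤ N := by exact_mod_cast hN
    linarith
  -- `h`: `cN²(N−1)(γ/2 − T²I) ≤ (N−1)(cN²(γ/2 − T²I) + s + CN)`, i.e. `0 ≤ (N−1)(s + CN)`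
  have key : 0 ≤ ((N : ℝ) - 1) *
      (contactSurplus (pinnedChain ω₂ lam β γ) T N (c * (N : ℝ) ^ 2) + C * N) := by nlinarith
  have key' : 0 ≤ contactSurplus (pinnedChain ω₂ lam β γ) T N (c * (N : ℝ) ^ 2) + C * N :=
    (mul_nonneg_iff_of_pos_left (show (0 : ℝ) < (N : ℝ) - 1 by linarith)).mp key
  linarith

/-- **`EquilibriumSurplusFloor ⟺ BoundedResponse` under the bracket** `K_T ∧ W ∧ (S)` and the fixed-`N`
identities `(R) ∧ (GK) ∧ (Q)`. [folklore] -/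
theorem boundedResponse_iff_equilibriumSurplusFloor (hK : TransientContactBudgetFixedN)
    (hW : ExtensiveBlockEnergyVariance) (hR : ContactKernelRegular) (hG : ContactGreenKubo)
    (hQ : TransientContactHeatNonneg) (hS : SubdiffusiveBondHeat) :
    BoundedResponse ↔ EquilibriumSurplusFloor :=
  ⟨fun hB => equilibriumSurplusFloor_of_boundedResponse hR hG hQ hB,
    fun hE => boundedResponse_of_transientContact' hK hW
      (transientContactSurplus_of_equilibriumSurplusFloor hR hG hE) hS⟩

end Summit.AtomisticToContinuum.FouriersLaw.Theorems.BoundedResponse.TransientContact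

end
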